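import Literature.Computability.AlgebraicComplexity.IK2020ShiftLemmaProofs
import Literature.NumberTheory.DiophantineGeometry.DetOrbitSymKroneckerBound
import Literature.Computability.AlgebraicComplexity.OrbitMultiplicitySemigroup
import Literature.NumberTheory.DiophantineGeometry.SymmetricGroupCharacterSums
import Literature.NumberTheory.DiophantineGeometry.SymmetricGroupRepsKroneckerCharacterProofs
import Literature.NumberTheory.DiophantineGeometry.SymmetricGroupRepsYoungSymmetrizerMulSelfProofs
import Mathlib.LinearAlgebra.Trace
import Mathlib.LinearAlgebra.PiTensorProduct.Finite
import HarnessLib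

/-!
# `mult_{λ^*} ℂ[\overline{G f}] ≤ dim {λ}^{stab f}` — the orbit-closure multiplicity is bounded by
# the invariants of the stabilizer (Ikenmeyer–Kandasamy 2020, §1/§4/§9; proved)

Cell `val-lit`, row IK2020-A (EXTEND of the §9 dictionary of `IK20HighestWeightVectors.lean`).
Honest framing: a classical GCT upper bound, proved in the tree's vocabulary; VP ≠ VNP is NOT
proved and nothing here is progress on it.

## The printed statement

Ikenmeyer–Kandasamy, STOC 2020 = arXiv:1911.03990. §1 (TeX L205–215): "`ℂ[GL_{n²}det_n] =
ℂ[GL_{n²}]^{H_{det_n}}` … the algebraic Peter–Weyl theorem … implies that the multiplicity of `λ^*`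
in `ℂ[GL_{n²} det_n]` equals the dimension of the `H_{det_n}`-invariant space `{λ}^{H_{det_n}}`";
(TeX L247) "`ℂ[\overline{GL_{n²}det_n}] ⊆ ℂ[GL_{n²}det_n]` is a subalgebra, and hence we have
`mult_λ ℂ[GL_{n²} det_n] ≥ mult_λ ℂ[\overline{GL_{n²} det_n}]`"; §4 (TeX L460–461) "`ℂ[\overline{Gq}] ⊆
ℂ[Gq]` is a subalgebra, so `mult_{ν^*} ℂ[\overline{Gq}] ≤ mult_{ν^*} ℂ[Gq]`"; §9 (9.3)–(9.4) (TeX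
L769–798) "`ℂ[Gp] ≅ ℂ[G]^H`", "`HWV_{λ^*}(ℂ[G]^H) ≃ {λ}^H`". The same chain is BLMW 2011 §4.1
(`ℂ[G/H] = ⊕_λ V_λ^* ⊗ V_λ^H`) with §4.4/§5.2 (5.2.7) (`ℂ[\overline{GL(W)·det_n}]_δ ⊆ ℂ[GL(W)·det_n]`).
Combined: for every form `f` with stabilizer `H ≤ GL_m` and every partition `λ` with at most `m`
parts,

  `mult_{λ^*} ℂ[\overline{GL_m · f}] ≤ dim {λ}^H`.

This file PROVES that inequality (`IK2020.orbitMultiplicity_le_weylInvariantDim`), for every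
`f : MvPolynomial (Fin m) k`, every degree `D` of the coefficient space, every `λ` with `ℓ(λ) ≤ m`
and every field `k` of characteristic zero, in the tree's letters: `orbitMultiplicity k f D λ^*`
(G20's `orbitCoordRep`, `SchurWeylPlethysm.lean`) `≤ IK2020.weylInvariantDim k m λ (linStabilizer f)`
(`IK20HighestWeightVectors.lean`: `dim` of the `H`-invariants of Weyl's `{λ} = c_λ · (k^m)^{⊗n}`).
The orbit ring `ℂ[Gp]` itself and the Peter–Weyl EQUALITY are not rendered (as before); only the
inequality, which is what every obstruction argument uses, is.

## Proof (no Peter–Weyl theorem; BLMW's bound space)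

* The tree's `finrank_highestWeightSpace_orbitCoordRep_le` (`SchurWeylPlethysmKroneckerBoundProofs`,
  §1–§3′ there; Fulton–Harris Lemma 6.23): a `B`-semi-invariant class of weight `χ = λ^*` in
  `k[\overline{GL·f}]` is a polynomial on `Mat_m` with an `𝔖_n`-invariant coefficient matrix whose
  columns lie in the transposed weight space `Y` of `χ` (`≅ [λ]` as an `𝔖_n`-module,
  `character_transposedPermRep_dualOfPartition`) and whose rows are fixed by any stabilizing family
  — here the whole stabilizer `H`, rows in `X = ((k^m)^{⊗n})^H` (word model); hence
  `mult ≤ dim T`, `T ≅ (Y ⊗ X)^{𝔖_n}`, and `n! · dim T = ∑_τ χ^λ(τ) χ_X(τ)`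
  (`card_mul_finrank_boundSpace`).
* §A `IK2020.factorial_mul_finrank_range_youngSymmetrizer`: for ANY finite-dimensional
  `𝔖_n`-module `M` in characteristic zero, `n! · dim (c_λ · M) = ∑_τ χ^λ(τ) χ_M(τ)` (the Young
  symmetrizer is a quasi-idempotent, `c_λ² = n_λ c_λ`, so `dim c_λ M = tr(c_λ|M)/n_λ`; the trace is
  `∑_x c_λ(x) χ_M(x)`, averaged over conjugates and evaluated with the tree's
  `n_λ χ^λ(g) = ∑_x c_λ(x⁻¹g⁻¹x)`, `coeff_sq_mul_spechtCharacter_eq_sum`). Fulton–Harris Lemma 4.26.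
* §B `IK2020.weylInvariantDim_eq_finrank_range_youngSymmetrizer`: `{λ}^H = c_λ · ((k^m)^{⊗n})^H`
  (`c_λ` commutes with `GL_m`, Fulton–Harris Lemma 6.22, and `c_λ y = n_λ y` on `{λ}`).
* §C the coordinate isomorphism `wordCoord` (`TensorWordModel`) identifies the `H`-fixed tensors
  with the `H`-fixed words `𝔖_n`-equivariantly, so `χ_X` is the character of §B's module.
* §D `n! · dim T = ∑_τ χ^λ χ_X = n! · dim {λ}^H`, whence `mult ≤ dim T = dim {λ}^H`.
* §E with `IK2020.weylInvariantDim_eq_addRect` (`IK2020ShiftLemmaProofs.lean`): if `det^ℓ` is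
  trivial on `H` then also `mult_{(λ+(m×ℓ))^*} ≤ dim {λ}^H`; for `p = x₁^D + ⋯ + x_m^D` and IK's
  exponent `e` of Lemma 5.2 this is the inequality `≤` of the first equality of **Lemma 5.2**
  (`IK2020_lemma_5_2_le`, PROVED; the reverse inequality is the Main Technical Theorem 4.2 with
  Prop. 4.1 and remains the open content of the fact `IK2020_lemma_5_2`).
* `IK2020.not_hasHighestWeight_orbitCoordRep_of_weylInvariantDim_eq_zero`: no `H`-invariants in
  `{λ}` ⇒ `λ^*` does not occur in `k[\overline{GL_m·f}]` (BLMW §4.5's observation, `GL`-reading).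

## References

* C. Ikenmeyer, U. Kandasamy, STOC 2020 = arXiv:1911.03990, §1 (L205–215, L247), §4 (L460–461),
  §5 Lemma 5.2, §9 (9.3)–(9.4). [IkenmeyerKandasamy2019]
* P. Bürgisser, J. M. Landsberg, L. Manivel, J. Weyman, SIAM J. Comput. 40 (2011), §4.1, §4.4–4.5,
  §5.2 (5.2.7). [BLMW2011]
* W. Fulton, J. Harris, GTM 129, Lemma 4.26, Lemma 6.22, Lemma 6.23, §2.4 (2.32). [FultonHarrisGTM129]

## Design

Theorems only (no new definitions, no named facts). `namespace IK2020` for the tools; the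
IK-numbered consequence `IK2020_lemma_5_2_le` at the file's namespace root next to the fact it
halves. The `𝔖_n`-representation on the `H`-fixed tensors is Mathlib's
`Representation.subrepresentation` of `permTensorRep` (stability: `invariants_glTensorRep_le_comap`);
coercion and transport lemmas are private plumbing.
-/

noncomputable section

open MvPolynomial
open scoped BigOperators

namespace Literature.Computability.AlgebraicComplexity

open _root_.Literature.NumberTheory.DiophantineGeometry

namespace IK2020

/-! ### §A The rank of a Young symmetrizer on a representation of `𝔖_d` -/

section YoungRank

variable {k : Type*} [Field k] {d : ℕ} {M : Type*} [AddCommGroup M] [Module k M]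

/-- The trace of a group-algebra element acting on a finite-dimensional representation:
`tr(ρ(a)) = ∑_x a(x) χ_ρ(x)`. Fulton–Harris §2.4 (proof of Prop. 2.30). [folklore] -/
private theorem trace_asAlgebraHom (ρ : Representation k (Equiv.Perm (Fin d)) M)
    (a : MonoidAlgebra k (Equiv.Perm (Fin d))) :
    LinearMap.trace k M (ρ.asAlgebraHom a) = ∑ x, a.coeff x * ρ.character x := by
  rw [Representation.asAlgebraHom_def, MonoidAlgebra.lift_apply,
    Finsupp.sum_fintype _ _ (fun x => by rw [zero_smul]), map_sum]
  refine Finset.sum_congr rfl fun x _ => ?_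
  rw [map_smul, smul_eq_mul]
  rfl

/-- Conjugating the group-algebra element does not change `∑_x a(x) χ_ρ(x)` (characters are class
functions). Fulton–Harris Prop. 2.1. [folklore] -/
private theorem sum_coeff_conj_mul_character (ρ : Representation k (Equiv.Perm (Fin d)) M)
    (a : MonoidAlgebra k (Equiv.Perm (Fin d))) (y : Equiv.Perm (Fin d)) :
    ∑ x, a.coeff (y⁻¹ * x * y) * ρ.character x = ∑ x, a.coeff x * ρ.character x := by
  refine Fintype.sum_equiv ((Equiv.mulLeft y⁻¹).trans (Equiv.mulRight y)) _ _ fun x => ?_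
  simp only [Equiv.trans_apply, Equiv.coe_mulLeft, Equiv.coe_mulRight]
  congr 1
  have h := Representation.char_conj (ρ := ρ) (y⁻¹ * x * y) y
  rw [show y * (y⁻¹ * x * y) * y⁻¹ = x by group] at h
  exact h

/-- **The rank of a Young symmetrizer**: for every finite-dimensional representation `ρ` of `𝔖_d`
over a field of characteristic zero and every `μ ⊢ d`,
`d! · dim (c_μ · M) = ∑_{x ∈ 𝔖_d} χ^μ(x) χ_ρ(x)`, i.e. `dim c_μ M = ⟨χ^μ, χ_ρ⟩` is the multiplicity of
the Specht module `S^μ` in `M` (`c_μ` acts as a rank-one quasi-idempotent on `S^μ` and as `0` on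
`S^ν`, `ν ≠ μ`). Proof: `c_μ² = n_μ c_μ` (`youngSymmetrizer_sq`), so `n_μ⁻¹ ρ(c_μ)` is an idempotent
with the same range and `dim = tr`; `tr ρ(c_μ) = ∑_x c_μ(x) χ_ρ(x)`, averaged over conjugates and
evaluated with the tree's `n_μ χ^μ(g) = ∑_x c_μ(x⁻¹ g⁻¹ x)` (`coeff_sq_mul_spechtCharacter_eq_sum`).
Fulton–Harris Lemma 4.26 / §2.4 (2.32). [cite: FultonHarrisGTM129, Lemma 4.26] -/
theorem factorial_mul_finrank_range_youngSymmetrizer [CharZero k] [FiniteDimensional k M]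
    (ρ : Representation k (Equiv.Perm (Fin d)) M) (μ : Nat.Partition d) :
    ((d.factorial : ℕ) : k) *
        (Module.finrank k (LinearMap.range (ρ.asAlgebraHom (youngSymmetrizer k μ))) : k) =
      ∑ x, spechtCharacter k μ x * ρ.character x := by
  classical
  set c := youngSymmetrizer k μ with hc
  set n : k := (c * c).coeff 1 with hn
  have hn0 : n ≠ 0 := coeff_sq_youngSymmetrizer_ne_zero k μ
  set P : M →ₗ[k] M := ρ.asAlgebraHom c with hP
  have hPP : P * P = n • P := by
    rw [hP, ← map_mul, youngSymmetrizer_sq k μ, map_smul]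
  have he : IsIdempotentElem (n⁻¹ • P) := by
    change (n⁻¹ • P) * (n⁻¹ • P) = n⁻¹ • P
    rw [Algebra.smul_mul_assoc, Algebra.mul_smul_comm, hPP, smul_smul, smul_smul,
      mul_assoc, inv_mul_cancel₀ hn0, mul_one]
  have hrange : LinearMap.range (n⁻¹ • P) = LinearMap.range P :=
    LinearMap.range_smul _ _ (inv_ne_zero hn0)
  have htr : LinearMap.trace k M (n⁻¹ • P) = (Module.finrank k (LinearMap.range P) : k) := by
    rw [(LinearMap.IsIdempotentElem.isProj_range _ he).trace, hrange]
  -- `d! · ∑_x c(x) χ(x) = n · ∑_x χ^μ(x) χ(x)`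
  have key : ((d.factorial : ℕ) : k) * ∑ x, c.coeff x * ρ.character x =
      n * ∑ x, spechtCharacter k μ x * ρ.character x := by
    calc ((d.factorial : ℕ) : k) * ∑ x, c.coeff x * ρ.character x
        = ∑ y : Equiv.Perm (Fin d), ∑ x, c.coeff (y⁻¹ * x * y) * ρ.character x := by
          rw [Finset.sum_congr rfl fun y _ => sum_coeff_conj_mul_character ρ c y,
            Finset.sum_const, Finset.card_univ, Fintype.card_perm, Fintype.card_fin,
            nsmul_eq_mul]
      _ = ∑ x, (∑ y : Equiv.Perm (Fin d), c.coeff (y⁻¹ * x * y)) * ρ.character x := by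
          rw [Finset.sum_comm]
          exact Finset.sum_congr rfl fun x _ => by rw [Finset.sum_mul]
      _ = ∑ x, (n * spechtCharacter k μ x) * ρ.character x := by
          refine Finset.sum_congr rfl fun x _ => ?_
          rw [← spechtCharacter_inv k μ x, hn, hc, coeff_sq_mul_spechtCharacter_eq_sum k μ x⁻¹,
            inv_inv]
      _ = n * ∑ x, spechtCharacter k μ x * ρ.character x := by
          rw [Finset.mul_sum]
          exact Finset.sum_congr rfl fun x _ => by rw [mul_assoc]
  -- assemble
  have h1 : ((d.factorial : ℕ) : k) * (Module.finrank k (LinearMap.range P) : k) =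
      n⁻¹ * (((d.factorial : ℕ) : k) * ∑ x, c.coeff x * ρ.character x) := by
    rw [← htr, map_smul, smul_eq_mul, trace_asAlgebraHom]
    ring
  rw [h1, key, ← mul_assoc, inv_mul_cancel₀ hn0, one_mul]

end YoungRank

/-! ### §B Invariants of `H ≤ GL_m` in the Weyl module `{λ} = c_λ · (k^m)^{⊗n}` -/

section WeylInvariants

variable (k : Type*) [Field k] (m n : ℕ) (H : Subgroup (GL (Fin m) k))

/-- The tensors of `(k^m)^{⊗n}` fixed by a subgroup `H ≤ GL_m` (under the diagonal action) form an
`𝔖_n`-stable subspace, because the two actions commute (Fulton–Harris Lemma 6.22); this is the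
stability proof feeding Mathlib's `Representation.subrepresentation`, so that
`(permTensorRep k (Fin m → k) n).subrepresentation _ (invariants_glTensorRep_le_comap k m n H)` is
the representation of `𝔖_n` on `((k^m)^{⊗n})^H`. [cite: FultonHarrisGTM129, Lemma 6.22] -/
theorem invariants_glTensorRep_le_comap (τ : Equiv.Perm (Fin n)) :
    Representation.invariants ((glTensorRep (Fin m) k n).comp H.subtype) ≤
      (Representation.invariants ((glTensorRep (Fin m) k n).comp H.subtype)).comap
        (permTensorRep k (Fin m → k) n τ) := by
  intro x hx
  rw [Submodule.mem_comap, Representation.mem_invariants]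
  rw [Representation.mem_invariants] at hx
  intro h
  change glTensorRep (Fin m) k n h (permTensorRep k (Fin m → k) n τ x) = _
  rw [← LinearMap.comp_apply, ← permTensorRep_comp_glTensorRep, LinearMap.comp_apply]
  exact congrArg _ (hx h)

/-- The group algebra acts on the `H`-fixed tensors by restriction of its action on all tensors
(coercion lemma). [folklore] -/
private theorem coe_subrepresentation_invariants_asAlgebraHom (a : MonoidAlgebra k (Equiv.Perm (Fin n)))
    (x : Representation.invariants ((glTensorRep (Fin m) k n).comp H.subtype)) :
    ((((permTensorRep k (Fin m → k) n).subrepresentation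
        (Representation.invariants ((glTensorRep (Fin m) k n).comp H.subtype))
        (invariants_glTensorRep_le_comap k m n H)).asAlgebraHom a x :
        Representation.invariants ((glTensorRep (Fin m) k n).comp H.subtype)) :
        TensorPower k n (Fin m → k)) =
      (permTensorRep k (Fin m → k) n).asAlgebraHom a (x : TensorPower k n (Fin m → k)) := by
  rw [Representation.asAlgebraHom_def, Representation.asAlgebraHom_def, MonoidAlgebra.lift_apply,
    MonoidAlgebra.lift_apply, Finsupp.sum, Finsupp.sum, LinearMap.coe_sum, Finset.sum_apply,
    Submodule.coe_sum, LinearMap.coe_sum, Finset.sum_apply]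
  refine Finset.sum_congr rfl fun τ _ => ?_
  rfl

variable {n} in
/-- **`{λ}^H = c_λ · ((k^m)^{⊗n})^H`** (dimension form): the `H`-invariants of the Weyl module
`{λ} = c_λ · (k^m)^{⊗n}` are the image under the Young symmetrizer of the `H`-fixed tensors —
`⊇` because `c_λ` commutes with `GL_m`, `⊆` because `c_λ y = n_λ y` on `{λ}` (`c_λ² = n_λ c_λ`,
`n_λ ≠ 0`). Fulton–Harris Lemma 6.22 / Lemma 4.26. [cite: FultonHarrisGTM129, Lemma 6.22] -/
theorem weylInvariantDim_eq_finrank_range_youngSymmetrizer [CharZero k] (lam : Nat.Partition n) :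
    weylInvariantDim k m lam H =
      Module.finrank k (LinearMap.range
        (((permTensorRep k (Fin m → k) n).subrepresentation
        (Representation.invariants ((glTensorRep (Fin m) k n).comp H.subtype))
        (invariants_glTensorRep_le_comap k m n H)).asAlgebraHom (youngSymmetrizer k lam))) := by
  classical
  set T := TensorPower k n (Fin m → k) with hT
  set πT := permTensorRep k (Fin m → k) n with hπT
  set c := youngSymmetrizer k lam with hc
  set nl : k := (c * c).coeff 1 with hnl
  have hnl0 : nl ≠ 0 := coeff_sq_youngSymmetrizer_ne_zero k lam
  set X' := Representation.invariants ((glTensorRep (Fin m) k n).comp H.subtype) with hX'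
  -- the two subspaces of `T`
  set Aw := Representation.invariants (k := k) (G := H) (V := weylModule k (Fin m) lam)
    ((weylRep k (Fin m) lam).comp H.subtype) with hAw
  set A := Aw.map (weylModule k (Fin m) lam).subtype with hA
  set B := (LinearMap.range (((permTensorRep k (Fin m → k) n).subrepresentation
        (Representation.invariants ((glTensorRep (Fin m) k n).comp H.subtype))
        (invariants_glTensorRep_le_comap k m n H)).asAlgebraHom c)).map X'.subtype with hB
  have hAB : A = B := by
    apply le_antisymm
    · rintro _ ⟨y, hy, rfl⟩
      rw [hAw, SetLike.mem_coe, Representation.mem_invariants] at hy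
      -- `y = c w`, hence `y = nl⁻¹ c y`
      obtain ⟨w, hw⟩ := y.2
      have hyT : (y : T) = πT.asAlgebraHom c ((nl⁻¹ : k) • (y : T)) := by
        rw [map_smul, ← hw, ← Module.End.mul_apply, ← map_mul, youngSymmetrizer_sq k lam, map_smul,
          LinearMap.smul_apply, smul_smul, inv_mul_cancel₀ hnl0, one_smul]
      -- `nl⁻¹ y` is `H`-fixed
      have hfix : (nl⁻¹ : k) • (y : T) ∈ X' := by
        rw [hX', Representation.mem_invariants]
        intro h
        have := congrArg (fun z : weylModule k (Fin m) lam => (z : T)) (hy h)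
        change glTensorRep (Fin m) k n h (y : T) = (y : T) at this
        change glTensorRep (Fin m) k n h ((nl⁻¹ : k) • (y : T)) = _
        rw [map_smul, this]
      refine ⟨((permTensorRep k (Fin m → k) n).subrepresentation
        (Representation.invariants ((glTensorRep (Fin m) k n).comp H.subtype))
        (invariants_glTensorRep_le_comap k m n H)).asAlgebraHom c ⟨_, hfix⟩, ⟨⟨_, hfix⟩, rfl⟩, ?_⟩
      rw [Submodule.coe_subtype, coe_subrepresentation_invariants_asAlgebraHom, Submodule.coe_subtype]
      exact hyT.symm
    · rintro _ ⟨z, ⟨x, rfl⟩, rfl⟩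
      have hmem : (πT.asAlgebraHom c (x : T)) ∈ weylModule k (Fin m) lam := ⟨(x : T), rfl⟩
      refine ⟨⟨πT.asAlgebraHom c (x : T), hmem⟩, ?_, ?_⟩
      · rw [hAw, SetLike.mem_coe, Representation.mem_invariants]
        intro h
        apply Subtype.ext
        rw [MonoidHom.coe_comp, Function.comp_apply, coe_weylRep_apply]
        change (glTensorRep (Fin m) k n h ∘ₗ πT.asAlgebraHom c) (x : T) = πT.asAlgebraHom c (x : T)
        rw [← asAlgebraHom_permTensorRep_comp_glTensorRep, LinearMap.comp_apply]
        have hx := (Representation.mem_invariants _ _).1 x.2 h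
        exact congrArg _ hx
      · rw [Submodule.coe_subtype, Submodule.coe_subtype, coe_subrepresentation_invariants_asAlgebraHom]
  unfold weylInvariantDim
  rw [← hAw, ← Submodule.finrank_map_subtype_eq _ Aw, ← Submodule.finrank_map_subtype_eq X', ← hA,
    ← hB, hAB]

end WeylInvariants

/-! ### §C The word model: `H`-fixed words and their `𝔖_n`-character -/

section WordModel

variable (k : Type*) [Field k] (m n : ℕ) (H : Subgroup (GL (Fin m) k))

/-- The `H`-fixed vectors of the word model `Word m n → k` of `(k^m)^{⊗n}` are `𝔖_n`-stable (the
position action commutes with the Kronecker powers, `wordPerm_wordRep`). [folklore] -/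
private theorem invariants_wordRep_le_comap (τ : Equiv.Perm (Fin n)) :
    Representation.invariants ((wordRep k m n).comp H.subtype) ≤
      (Representation.invariants ((wordRep k m n).comp H.subtype)).comap (wordPermRep k m n τ) := by
  intro x hx
  rw [Submodule.mem_comap, Representation.mem_invariants]
  rw [Representation.mem_invariants] at hx
  intro h
  change wordRep k m n h (wordPerm k τ x) = wordPerm k τ x
  rw [← wordPerm_wordRep, show wordRep k m n h x = x from hx h]

/-- Coordinates of the permutation action: `wordCoord (τ · v) = τ · wordCoord v`
(`tensorBasis_repr_permTensorRep` of `SchurWeylPlethysmProofs` in the letters of `TensorWordModel`).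
[folklore] -/
private theorem wordCoord_permTensorRep (τ : Equiv.Perm (Fin n)) (v : TensorPower k n (Fin m → k)) :
    wordCoord k m n (permTensorRep k (Fin m → k) n τ v) = wordPerm k τ (wordCoord k m n v) := by
  funext w
  rw [wordPerm_apply, wordCoord_eq_repr, wordCoord_eq_repr, tensorBasis_repr_permTensorRep]

/-- `wordCoord` maps the `H`-fixed tensors onto the `H`-fixed words. [folklore] -/
private theorem map_wordCoord_invariants :
    (Representation.invariants ((glTensorRep (Fin m) k n).comp H.subtype)).map
        (wordCoord k m n).toLinearMap =
      Representation.invariants ((wordRep k m n).comp H.subtype) := by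
  apply le_antisymm
  · rintro _ ⟨v, hv, rfl⟩
    rw [SetLike.mem_coe, Representation.mem_invariants] at hv
    rw [Representation.mem_invariants]
    intro h
    change wordRep k m n h (wordCoord k m n v) = wordCoord k m n v
    rw [← wordCoord_glTensorRep, show glTensorRep (Fin m) k n h v = v from hv h]
  · intro x hx
    rw [Representation.mem_invariants] at hx
    refine ⟨(wordCoord k m n).symm x, ?_, (wordCoord k m n).apply_symm_apply x⟩
    rw [SetLike.mem_coe, Representation.mem_invariants]
    intro h
    apply (wordCoord k m n).injective
    change wordCoord k m n (glTensorRep (Fin m) k n h ((wordCoord k m n).symm x)) = _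
    rw [wordCoord_glTensorRep, LinearEquiv.apply_symm_apply]
    exact hx h

/-- **The `𝔖_n`-characters of the `H`-fixed tensors and of the `H`-fixed words agree** (the
coordinate isomorphism `wordCoord` restricts to an equivalence of `𝔖_n`-representations).
[folklore] -/
private theorem character_invariants_wordRep_eq :
    ((wordPermRep k m n).subrepresentation
        (Representation.invariants ((wordRep k m n).comp H.subtype))
        (invariants_wordRep_le_comap k m n H)).character =
      Representation.character
        (V := Representation.invariants ((glTensorRep (Fin m) k n).comp H.subtype))
        ((permTensorRep k (Fin m → k) n).subrepresentation
        (Representation.invariants ((glTensorRep (Fin m) k n).comp H.subtype))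
        (invariants_glTensorRep_le_comap k m n H)) := by
  symm
  refine Representation.char_iso (Representation.Equiv.mk
    (LinearEquiv.ofSubmodules (wordCoord k m n) _ _ (map_wordCoord_invariants k m n H))
    fun τ => LinearMap.ext fun x => Subtype.ext ?_)
  change wordCoord k m n (((((permTensorRep k (Fin m → k) n).subrepresentation
        (Representation.invariants ((glTensorRep (Fin m) k n).comp H.subtype))
        (invariants_glTensorRep_le_comap k m n H)) τ x :
      Representation.invariants ((glTensorRep (Fin m) k n).comp H.subtype)) :
      TensorPower k n (Fin m → k))) =
    wordPerm k τ (wordCoord k m n (x : TensorPower k n (Fin m → k)))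
  rw [← wordCoord_permTensorRep]
  rfl

end WordModel

/-! ### §D The bound -/

section Bound

variable (k : Type*) [Field k] [CharZero k] {m n : ℕ}

omit [CharZero k] in
/-- Reindexing along the identity order isomorphism is the identity. [folklore] -/
private theorem reindexGL_refl (g : GL (Fin m) k) : reindexGL (OrderIso.refl (Fin m)) g = g := by
  apply Units.ext
  rw [coe_reindexGL]
  rfl

/-- **`mult_{λ^*} k[\overline{GL_m · f}] ≤ dim {λ}^{stab f}`** — for every polynomial `f` in `m`
variables, every degree `D`, every partition `λ` with at most `m` parts and every field `k` of
characteristic zero: the multiplicity of the highest weight `λ^*` in the coordinate ring of the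
orbit closure `\overline{GL_m · f} ⊆ Sym^D k^m` (G20's `orbitCoordRep f D`, tree `orbitMultiplicity`)
is at most the dimension of the `H`-invariants of the Weyl module `{λ}`, `H = stab f`
(`IK2020.weylInvariantDim`). This is the printed chain "`ℂ[\overline{Gp}] ⊆ ℂ[Gp]` is a subalgebra, so
`mult_{λ^*} ℂ[\overline{Gp}] ≤ mult_{λ^*} ℂ[Gp]`" (IK §4, TeX L460–461; §1 L247) with
"`ℂ[Gp] ≅ ℂ[G]^H`, `HWV_{λ^*}(ℂ[G]^H) ≃ {λ}^H`" (IK §9 (9.3)–(9.4), TeX L769–798; the algebraic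
Peter–Weyl theorem, §1 L205–215; BLMW 2011 §4.1 and (5.2.7) for `det_n`), proved here WITHOUT the
Peter–Weyl theorem: a highest-weight vector of weight `λ^*` gives an `𝔖_n`-invariant coefficient
matrix with columns in the transposed weight space `Y ≅ [λ]` and rows in the `H`-fixed words `X`
(tree `finrank_highestWeightSpace_orbitCoordRep_le`, BLMW's bound space `T ≅ (Y ⊗ X)^{𝔖_n}`), and
`n! · dim T = ∑_τ χ^λ(τ) χ_X(τ) = n! · dim c_λ · X = n! · dim {λ}^H` (§A–§C). Equality (the printed
statement for the ORBIT ring) is not claimed. [cite: IkenmeyerKandasamy2019, §4 (TeX L460–461) with §9 (9.3)–(9.4)]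
[cite: BLMW2011, §4.1 with §5.2 (5.2.7)] -/
theorem orbitMultiplicity_le_weylInvariantDim (f : MvPolynomial (Fin m) k) (D : ℕ)
    (lam : Nat.Partition n) (hlam : lam.parts.card ≤ m) :
    orbitMultiplicity k f D (Weight.dualOfPartition m lam) ≤
      weylInvariantDim k m lam (linStabilizer f) := by
  classical
  set H := linStabilizer f with hH
  set χ := Weight.dualOfPartition m lam with hχ
  set X := Representation.invariants ((wordRep k m n).comp H.subtype) with hX
  have hsize : χ.size = -(n : ℤ) := by
    rw [hχ, Weight.dualOfPartition, Weight.size_dual, Weight.size_ofPartition_holds hlam]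
  -- §D.1 the bound-space inequality
  have h1 : Module.finrank k (highestWeightSpace (orbitCoordRep f D) χ) ≤
      Module.finrank k (boundSpace k (χ ∘ ⇑(OrderIso.refl (Fin m))) X) :=
    finrank_highestWeightSpace_orbitCoordRep_le f D χ (OrderIso.refl (Fin m)) hsize X (· ∈ H)
      (fun x hx => (Representation.mem_invariants _ _).2 fun h => hx h h.2)
      (fun h hh => by rw [reindexGL_refl]; exact hh)
  have hχe : (χ ∘ ⇑(OrderIso.refl (Fin m))) = χ := rfl
  rw [hχe] at h1
  -- §D.2 counting the bound space
  have h2 := card_mul_finrank_boundSpace k χ X (invariants_wordRep_le_comap k m n H)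
  rw [hχ, character_transposedPermRep_dualOfPartition k lam hlam, ← hχ,
    character_invariants_wordRep_eq, Fintype.card_perm, Fintype.card_fin] at h2
  -- §D.3 counting the Weyl invariants
  have h3 := factorial_mul_finrank_range_youngSymmetrizer
    (M := Representation.invariants ((glTensorRep (Fin m) k n).comp H.subtype))
    ((permTensorRep k (Fin m → k) n).subrepresentation
        (Representation.invariants ((glTensorRep (Fin m) k n).comp H.subtype))
        (invariants_glTensorRep_le_comap k m n H)) lam
  rw [← weylInvariantDim_eq_finrank_range_youngSymmetrizer] at h3
  -- §D.4 compare
  have h4 : Module.finrank k (boundSpace k χ X) = weylInvariantDim k m lam H := by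
    have h := h2.trans h3.symm
    have hn : ((n.factorial : ℕ) : k) ≠ 0 := Nat.cast_ne_zero.2 (Nat.factorial_ne_zero n)
    exact_mod_cast mul_left_cancel₀ hn h
  unfold orbitMultiplicity hwMultiplicity
  exact h1.trans h4.le

/-- **Non-occurrence from the stabilizer** (contrapositive, occurrence form): if the Weyl module
`{λ}` has no nonzero `stab f`-invariant vector, then `λ^*` does not occur in `k[\overline{GL_m · f}]`
(`D ≠ 0`). BLMW 2011 §4.5 ("`w ∉ \overline{GL(W)·v}` if there is a module that contains a
`SL(W)(w)`-invariant that does not contain a `SL(W)(v)`-invariant", the `GL`-reading of its second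
half); IK §4 (TeX L460–461). [cite: BLMW2011, §4.5] -/
theorem not_hasHighestWeight_orbitCoordRep_of_weylInvariantDim_eq_zero (f : MvPolynomial (Fin m) k)
    {D : ℕ} (hD : D ≠ 0) (lam : Nat.Partition n) (hlam : lam.parts.card ≤ m)
    (h0 : weylInvariantDim k m lam (linStabilizer f) = 0) :
    ¬ HasHighestWeight (orbitCoordRep f D) (Weight.dualOfPartition m lam) := by
  rw [← orbitMultiplicity_pos_iff_hasHighestWeight f hD, not_lt, ← h0]
  exact orbitMultiplicity_le_weylInvariantDim k f D lam hlam

end Bound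

/-! ### §E Shifted weights: `mult_{(λ+(m×ℓ))^*} ≤ dim {λ}^H` when `det^ℓ` is trivial on `H` -/

section Shifted

variable (k : Type*) [Field k] [IsAlgClosed k] [CharZero k] {m n : ℕ}

/-- **`mult_{(λ + (m × ℓ))^*} k[\overline{GL_m · f}] ≤ dim {λ}^{stab f}`** whenever `det^ℓ` is trivial on
the stabilizer (the bound `orbitMultiplicity_le_weylInvariantDim` at the shifted partition combined
with `{λ + (m × ℓ)}^H ≃ {λ}^H`, `IK2020.weylInvariantDim_eq_addRect`). IK §5 (Lemma 5.1 with
§4 L460–461). [cite: IkenmeyerKandasamy2019, §5 Lemma 5.1–5.2] -/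
theorem orbitMultiplicity_addRect_le_weylInvariantDim (f : MvPolynomial (Fin m) k) (D : ℕ)
    (lam : Nat.Partition n) (hlam : lam.parts.card ≤ m) (ℓ : ℕ)
    (hH : ∀ g ∈ linStabilizer f, ((g : Matrix (Fin m) (Fin m) k).det) ^ ℓ = 1) :
    orbitMultiplicity k f D (Weight.dualOfPartition m (addRect lam m ℓ hlam)) ≤
      weylInvariantDim k m lam (linStabilizer f) := by
  rw [weylInvariantDim_eq_addRect k lam hlam ℓ (linStabilizer f) hH]
  exact orbitMultiplicity_le_weylInvariantDim k f D _ (card_parts_addRect_le lam m ℓ hlam)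

/-- IK's exponent `e` of Lemma 5.2 times `D` is an even multiple of `D` (for `D` odd, `e` is even
by definition). [cite: IkenmeyerKandasamy2019, Lemma 5.2] -/
theorem even_eCormain_mul (m d D : ℕ) : Even (eCormain m d D * D) := by
  unfold eCormain
  split_ifs with hD hdm hdm'
  · exact hD.mul_left d
  · exact hD.mul_left _
  · exact (even_two_mul d).mul_right D
  · exact (Even.add (even_two_mul m) (even_two_mul _)).mul_right D

end Shifted

/-! ### §F General alphabets: forms on `k^σ` along an order isomorphism `Fin N ≃o σ`, matrix spaces -/

section Reindexed

variable (k : Type*) [Field k] [CharZero k] {σ : Type*} [Fintype σ] [LinearOrder σ] {N n : ℕ}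

/-- **`mult_χ k[\overline{GL_σ · f}] ≤ dim {λ}^{H}` for forms in variables `σ` ordered by
`e : Fin N ≃o σ`** (the bound `orbitMultiplicity_le_weylInvariantDim` transported along `e`): for the
weight `χ` of `GL σ k` with `χ ∘ e = λ^*` (so `χ = λ^* ∘ e⁻¹`), the multiplicity of `χ` in
`k[\overline{GL_σ · f}]` is at most the dimension of the invariants of the Weyl module `{λ}` of
`GL_N` under the preimage `e^* H = {g | reindex e g ∈ stab f}` of the stabilizer (an isomorphic copy
of `stab f ≤ GL σ k` inside `GL_N`). Same proof as for `σ = Fin m` (tree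
`finrank_highestWeightSpace_orbitCoordRep_le` is already stated along `e`). IK §4 (TeX L460–461)
with §9 (9.3)–(9.4); BLMW 2011 §4.1, §5.2 (matrix spaces `W = E ⊗ F` ordered lexicographically).
[cite: IkenmeyerKandasamy2019, §4 (TeX L460–461) with §9 (9.3)–(9.4)] [cite: BLMW2011, §4.1 with §5.2 (5.2.7)] -/
theorem orbitMultiplicity_le_weylInvariantDim_of_orderIso (e : Fin N ≃o σ) (f : MvPolynomial σ k)
    (D : ℕ) (lam : Nat.Partition n) (hlam : lam.parts.card ≤ N) :
    orbitMultiplicity k f D (Weight.dualOfPartition N lam ∘ e.symm) ≤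
      weylInvariantDim k N lam ((linStabilizer f).comap (reindexGL e)) := by
  classical
  set H := (linStabilizer f).comap (reindexGL e) with hH
  set χ : Weight σ := Weight.dualOfPartition N lam ∘ e.symm with hχ
  set χ₀ := Weight.dualOfPartition N lam with hχ₀
  set X := Representation.invariants ((wordRep k N n).comp H.subtype) with hX
  have hχe : χ ∘ e = χ₀ := by
    funext i
    change Weight.dualOfPartition N lam (e.symm (e i)) = _
    rw [OrderIso.symm_apply_apply]
  have hsize : χ.size = -(n : ℤ) := by
    have h0 : χ₀.size = -(n : ℤ) := by
      rw [hχ₀, Weight.dualOfPartition, Weight.size_dual, Weight.size_ofPartition_holds hlam]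
    rw [← h0, Weight.size, Weight.size, ← hχe]
    exact (Fintype.sum_equiv e.toEquiv (fun i => (χ ∘ e) i) χ fun i => rfl).symm
  -- the bound-space inequality along `e`
  have h1 : Module.finrank k (highestWeightSpace (orbitCoordRep f D) χ) ≤
      Module.finrank k (boundSpace k (χ ∘ ⇑e) X) :=
    finrank_highestWeightSpace_orbitCoordRep_le f D χ e hsize X (· ∈ H)
      (fun x hx => (Representation.mem_invariants _ _).2 fun h => hx h h.2)
      (fun h hh => by exact hh)
  rw [hχe] at h1
  -- counting the bound space and the Weyl invariants
  have h2 := card_mul_finrank_boundSpace k χ₀ X (invariants_wordRep_le_comap k N n H)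
  rw [hχ₀, character_transposedPermRep_dualOfPartition k lam hlam, ← hχ₀,
    character_invariants_wordRep_eq, Fintype.card_perm, Fintype.card_fin] at h2
  have h3 := factorial_mul_finrank_range_youngSymmetrizer
    (M := Representation.invariants ((glTensorRep (Fin N) k n).comp H.subtype))
    ((permTensorRep k (Fin N → k) n).subrepresentation
        (Representation.invariants ((glTensorRep (Fin N) k n).comp H.subtype))
        (invariants_glTensorRep_le_comap k N n H)) lam
  rw [← weylInvariantDim_eq_finrank_range_youngSymmetrizer] at h3
  have h4 : Module.finrank k (boundSpace k χ₀ X) = weylInvariantDim k N lam H := by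
    have h := h2.trans h3.symm
    have hn : ((n.factorial : ℕ) : k) ≠ 0 := Nat.cast_ne_zero.2 (Nat.factorial_ne_zero n)
    exact_mod_cast mul_left_cancel₀ hn h
  unfold orbitMultiplicity hwMultiplicity
  exact h1.trans h4.le

/-- **Matrix spaces.** For a form `f` in the lexicographically ordered matrix variables `MatIdx m`
(the home of the tree's `detFormLex`, `paddedPerFormLex` and of the rung's weights
`(Weight.dualOfPartition (m*m) λ).toMatIdx`, cf. `PerDetMultiplicityObstructionAt`): the multiplicity
of `λ^*` (transported to `MatIdx m`) in `k[\overline{GL_{m²} · f}]` is at most `dim {λ}^{H}`, `{λ}` the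
Weyl module of `GL_{m²}` and `H` the stabilizer of `f` pulled back to `GL (Fin (m*m)) k` along
`matIdxEquiv m`. For `f = det_m` the tree's sharper-named instance is BLMW's
`orbitMultiplicity_det_le_symKroneckerCoeffRect` (`DetOrbitSymKroneckerBound.lean`), whose right
side `sk(λ, m × d)` is BLMW's value of `dim (S_λ W)^{H_{det}}` (Prop. 5.2.1 (5.2.6), the fact
`BLMW2011_prop_5_2_1_invariants`; not re-derived here). BLMW 2011 §5.2 (5.2.7); IK §1 (TeX
L205–215, L247). [cite: BLMW2011, §5.2 (5.2.7)] [cite: IkenmeyerKandasamy2019, §1 (TeX L205–215, L247)] -/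
theorem orbitMultiplicity_toMatIdx_le_weylInvariantDim {m : ℕ} (f : MvPolynomial (MatIdx m) k)
    (D : ℕ) (lam : Nat.Partition n) (hlam : lam.parts.card ≤ m * m) :
    orbitMultiplicity k f D (Weight.dualOfPartition (m * m) lam).toMatIdx ≤
      weylInvariantDim k (m * m) lam ((linStabilizer f).comap (reindexGL (matIdxEquiv m))) :=
  orbitMultiplicity_le_weylInvariantDim_of_orderIso k (matIdxEquiv m) f D lam hlam

end Reindexed

/-! ### §G `dim T_H = dim {λ}^H` for every subgroup; the determinant: `dim {λ}^{H_{det}} ≤ sk(λ, m × d)` -/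

section AnySubgroup

variable (k : Type*) [Field k] [CharZero k] {N n : ℕ}

omit [CharZero k] in
/-- The bound space is monotone in the row space (private plumbing). [folklore] -/
private theorem boundSpace_mono (χ : Weight (Fin N)) {X Y : Submodule k (Word N n → k)} (hXY : X ≤ Y) :
    boundSpace k χ X ≤ boundSpace k χ Y :=
  fun _ hL => ⟨hL.1, hL.2.1, fun I => hXY (hL.2.2 I)⟩

/-- **`dim T_H = dim {λ}^H` for every subgroup `H ≤ GL_N`**: BLMW's bound space with columns in the
transposed weight space of `λ^*` and rows in the `H`-fixed words has the dimension of the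
`H`-invariants of the Weyl module `{λ}` (`n! · dim T_H = ∑_τ χ^λ(τ) χ_{X_H}(τ) = n! · dim c_λ X_H =
n! · dim {λ}^H`, §A–§C). This is the tree-side form of "`(Y ⊗ X)^{𝔖_D}` … `dim (S_π W)^H`" in BLMW's
computation (§5.2, proof of Prop. 5.2.1), for an arbitrary subgroup in place of the stabilizer.
[cite: BLMW2011, §5.2 Prop. 5.2.1 (proof)] -/
theorem finrank_boundSpace_invariants_eq_weylInvariantDim (H : Subgroup (GL (Fin N) k))
    (lam : Nat.Partition n) (hlam : lam.parts.card ≤ N) :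
    Module.finrank k (boundSpace k (Weight.dualOfPartition N lam)
        (Representation.invariants ((wordRep k N n).comp H.subtype))) =
      weylInvariantDim k N lam H := by
  classical
  set X := Representation.invariants ((wordRep k N n).comp H.subtype) with hX
  have h2 := card_mul_finrank_boundSpace k (Weight.dualOfPartition N lam) X
    (invariants_wordRep_le_comap k N n H)
  rw [character_transposedPermRep_dualOfPartition k lam hlam, character_invariants_wordRep_eq,
    Fintype.card_perm, Fintype.card_fin] at h2
  have h3 := factorial_mul_finrank_range_youngSymmetrizer
    (M := Representation.invariants ((glTensorRep (Fin N) k n).comp H.subtype))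
    ((permTensorRep k (Fin N → k) n).subrepresentation
        (Representation.invariants ((glTensorRep (Fin N) k n).comp H.subtype))
        (invariants_glTensorRep_le_comap k N n H)) lam
  rw [← weylInvariantDim_eq_finrank_range_youngSymmetrizer] at h3
  have h := h2.trans h3.symm
  have hn : ((n.factorial : ℕ) : k) ≠ 0 := Nat.cast_ne_zero.2 (Nat.factorial_ne_zero n)
  exact_mod_cast mul_left_cancel₀ hn h

/-- **The determinant: `dim {λ}^{H_{det_m}} ≤ sk(λ, m × d)`** (`λ ⊢ m·d`, `ℓ(λ) ≤ m²`, characteristic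
zero; `H_{det_m} = stab(det_m)` pulled back to `GL_{m²}` along `matIdxEquiv m`). BLMW 2011, Prop. 5.2.1
(5.2.6) prints EQUALITY "`dim (S_π(E ⊗ F))^H = sk^π_{δⁿδⁿ}`" (the tree's fact
`BLMW2011_prop_5_2_1_invariants`, in the `schurRep (stdRep (MatIdx n))` rendering); proved here is
the inequality `≤`, from `dim {λ}^H = dim T_H` (`finrank_boundSpace_invariants_eq_weylInvariantDim`),
`T_H ⊆ T_S` for the stabilizing family `S` = {unimodular upper triangular `a ⊗ b`} ∪ {transposition}
(every `H`-fixed word is `S`-fixed, tree `linSubstRep_reindexGL_kronFin_detFormLex`,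
`linSubstRep_reindexGL_swapGL_detFormLex`) and the tree's DEFINITION `symKroneckerCoeffRect = dim T_S`
(`DetOrbitSymKroneckerBound.lean`). Composed with `orbitMultiplicity_toMatIdx_le_weylInvariantDim`
this recovers the tree's `orbitMultiplicity_det_le_symKroneckerCoeffRect` (the `example` below; not
restated under a new name). [cite: BLMW2011, §5.2 Prop. 5.2.1 (5.2.6)] -/
theorem weylInvariantDim_det_le_symKroneckerCoeffRect {m d : ℕ} (lam : Nat.Partition (m * d))
    (hlam : lam.parts.card ≤ m * m) :
    weylInvariantDim k (m * m) lam
        ((linStabilizer (detFormLex k m)).comap (reindexGL (matIdxEquiv m))) ≤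
      symKroneckerCoeffRect k m d lam := by
  rw [← finrank_boundSpace_invariants_eq_weylInvariantDim k _ lam hlam]
  unfold symKroneckerCoeffRect
  refine Submodule.finrank_mono (boundSpace_mono k _ fun x hx => ?_)
  rw [Representation.mem_invariants] at hx
  intro h hh
  have hmem : reindexGL (matIdxEquiv m) h ∈ linStabilizer (detFormLex k m) := by
    rw [mem_linStabilizer]
    rcases hh with ⟨a, b, ha, ha1, hb, hb1, rfl⟩ | rfl
    · exact linSubstRep_reindexGL_kronFin_detFormLex k m ha1 hb1
    · exact linSubstRep_reindexGL_swapGL_detFormLex k m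
  exact hx ⟨h, hmem⟩

/-- The tree's `orbitMultiplicity_det_le_symKroneckerCoeffRect` (BLMW (5.2.7) with (5.2.6)) as the
composite of the two inequalities of this file (derivation only; the named theorem of record stays
the one in `DetOrbitSymKroneckerBound.lean`). [cite: BLMW2011, §5.2 Prop. 5.2.1] -/
example {m d : ℕ} (lam : Nat.Partition (m * d)) (hlam : lam.parts.card ≤ m * m) :
    orbitMultiplicity k (detFormLex k m) m (Weight.dualOfPartition (m * m) lam).toMatIdx ≤
      symKroneckerCoeffRect k m d lam :=
  (orbitMultiplicity_toMatIdx_le_weylInvariantDim k (detFormLex k m) m lam hlam).trans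
    (weylInvariantDim_det_le_symKroneckerCoeffRect k lam hlam)

end AnySubgroup

end IK2020

open IK2020 in
/-- **Ikenmeyer–Kandasamy 2020, Lemma 5.2, the inequality `≤` of its first equality — PROVED**
(TeX L510–527: "`mult_{(λ+(m×eD))^*} ℂ[\overline{Gp}] = mult_{λ^*} ℂ[Gp]`", right side rendered via
(9.4) as `dim {λ}^H`, exactly as in the named fact `IK2020_lemma_5_2`): for `3 ≤ D ≤ m`, `λ ⊢_m dD`
and IK's `e = eCormain m d D`, `mult_{(λ+(m×eD))^*} ℂ[\overline{Gp}] ≤ dim {λ}^H`, `p = x₁^D + ⋯ + x_m^D`,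
`H = stab p`. Printed proof of this half: "`ℂ[\overline{Gp}] ⊆ ℂ[Gp]` is a subalgebra" (§4 L460–461)
and Lemma 5.1; here: `orbitMultiplicity_addRect_le_weylInvariantDim` with `det^{eD} = 1` on `H`
(`eD` is an even multiple of `D`; BI 2017 Prop. 2.4(2)). The reverse inequality is IK's Main
Technical Theorem 4.2 with Prop. 4.1 and stays the open half of the fact `IK2020_lemma_5_2`.
[cite: IkenmeyerKandasamy2019, Lemma 5.2] -/
theorem IK2020_lemma_5_2_le (m d D : ℕ) (hD : 3 ≤ D)
    (lam : Nat.Partition (d * D)) (h : lam.parts.card ≤ m) :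
    orbitMultiplicity ℂ (psum (Fin m) ℂ D) D
        (Weight.dualOfPartition m (addRect lam m (eCormain m d D * D) h)) ≤
      weylInvariantDim ℂ m lam (linStabilizer (psum (Fin m) ℂ D)) :=
  orbitMultiplicity_addRect_le_weylInvariantDim ℂ _ D lam h _ fun _ hg =>
    det_pow_eq_one_of_mem_linStabilizer_psum (by omega) (even_eCormain_mul m d D)
      (dvd_mul_left D _) hg

end Literature.Computability.AlgebraicComplexity
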